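import Summits.Parity.GeneralizedHardyLittlewood.Theorems.FordMaynardSieveConst01651SieveConst01651PairingTwoEntries
import HarnessLib

/-!
# Route `FordMaynardSieveConst01651`, target `SieveConst01651` (stmt-Parity-19185), stub `stub_certValuePos` (R2):
# an entry pairing as an integral over the `(y₁, y₂)`-plane

Def-free helper file (step (4) of the `certP`/`certN` soundness, see `…CertAssembly`).  For a table entry `e` and a
constant `κ`, the iterated pairing `∫_{t∈(0,1/2]} (∫_{u∈(0,t)} κ𝟙_{P_e}(t,u)/(u(t−u)) du) Φ₆(1−t) dt` equals the plane
integral `∫∫ 𝟙_{P_e}(y₁+y₂, y₁) κ Φ₆(1−y₁−y₂)/(y₁y₂) d(y₁,y₂)` (`entryPairing_eq_plane`): Fubini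
(`integral_integral_swap`), the translation `t = y₁ + y₂` of the inner integral (`integral_add_left_eq_self`), and
Fubini back (`integral_prod`); integrability from boundedness (`1/ν₀²`, `Φ₆` bounded) and bounded support.

References: [FordMaynard2024PrimeSieves] arXiv:2407.14368, §8.2; Fubini.
-/

noncomputable section

open MeasureTheory Set
open scoped Classical
open Literature.NumberTheory.Sieve Literature.NumberTheory.Sieve.FordMaynard
open Literature.Analysis.Convolution

namespace Summit.Parity.GeneralizedHardyLittlewood.FordMaynardSieveConst01651SieveConst01651

/-- **An entry pairing as a plane integral.** [folklore] -/
theorem entryPairing_eq_plane (e : ℕ × ℕ × ℕ × ℤ) (κ : ℝ) :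
    ∫ t in Set.Ioc 0 (1 / 2), (∫ u in Set.Ioo 0 t, κ *
        (if ((certEdge e.1 : ℚ) : ℝ) < u ∧ u < ((certEdge (e.1 + 1) : ℚ) : ℝ) ∧
            ((certEdge e.2.1 : ℚ) : ℝ) < t - u ∧ t - u < ((certEdge (e.2.1 + 1) : ℚ) : ℝ) ∧
            u ≤ t - u ∧ (if e.2.2.1 = 0 then t < 8349 / 20000 else 8349 / 20000 < t) ∧ t < 1 / 2
          then 1 / (u * (t - u)) else 0)) *
      ∑ m ∈ Finset.Icc 1 6, (1 / (m.factorial : ℝ)) *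
        cpow (fun t : ℝ => if (1651 / 10000 : ℝ) < t then 1 / t else 0) m (1 - t) =
    ∫ y : ℝ × ℝ, (if ((certEdge e.1 : ℚ) : ℝ) < y.1 ∧ y.1 < ((certEdge (e.1 + 1) : ℚ) : ℝ) ∧
            ((certEdge e.2.1 : ℚ) : ℝ) < y.2 ∧ y.2 < ((certEdge (e.2.1 + 1) : ℚ) : ℝ) ∧
            y.1 ≤ y.2 ∧ (if e.2.2.1 = 0 then y.1 + y.2 < 8349 / 20000 else 8349 / 20000 < y.1 + y.2) ∧
            y.1 + y.2 < 1 / 2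
        then κ * (∑ m ∈ Finset.Icc 1 6, (1 / (m.factorial : ℝ)) *
          cpow (fun t : ℝ => if (1651 / 10000 : ℝ) < t then 1 / t else 0) m (1 - (y.1 + y.2))) / (y.1 * y.2)
        else 0) ∂((volume : Measure ℝ).prod volume) := by
  have hν : (0 : ℝ) < 1651 / 10000 := by norm_num
  set Φ : ℝ → ℝ := fun x => ∑ m ∈ Finset.Icc 1 6, (1 / (m.factorial : ℝ)) *
    cpow (fun t : ℝ => if (1651 / 10000 : ℝ) < t then 1 / t else 0) m x with hΦ
  have hΦb : LocBdd Φ := locBdd_buchstabPhi hν 6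
  obtain ⟨C, hC0, hC⟩ := hΦb.bdd_nonneg 1
  -- the cell kernel and the full integrand `G(t, u)`
  set P : ℝ → ℝ → Prop := fun t u => ((certEdge e.1 : ℚ) : ℝ) < u ∧ u < ((certEdge (e.1 + 1) : ℚ) : ℝ) ∧
      ((certEdge e.2.1 : ℚ) : ℝ) < t - u ∧ t - u < ((certEdge (e.2.1 + 1) : ℚ) : ℝ) ∧
      u ≤ t - u ∧ (if e.2.2.1 = 0 then t < 8349 / 20000 else 8349 / 20000 < t) ∧ t < 1 / 2 with hP
  set G : ℝ → ℝ → ℝ := fun t u => (Set.Ioc (0 : ℝ) (1 / 2)).indicator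
      (fun t => ((Set.Ioo 0 t).indicator (fun u => if P t u then 1 / (u * (t - u)) else 0) u) * (κ * Φ (1 - t))) t
    with hG
  -- facts about the condition
  have hPpos : ∀ t u, P t u → (1651 / 10000 : ℝ) < u ∧ (1651 / 10000 : ℝ) < t - u ∧ t < 1 / 2 := by
    intro t u h
    exact ⟨lt_of_le_of_lt (nu_le_certEdge _) h.1, lt_of_le_of_lt (nu_le_certEdge _) h.2.2.1, h.2.2.2.2.2.2⟩
  -- `G` in closed form
  have hGval : ∀ t u, G t u = if P t u then κ * Φ (1 - t) / (u * (t - u)) else 0 := by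
    intro t u
    simp only [hG, Set.indicator, Set.mem_Ioc, Set.mem_Ioo]
    by_cases hp : P t u
    · obtain ⟨hu, htu, ht⟩ := hPpos t u hp
      rw [if_pos ⟨by linarith, ht.le⟩, if_pos ⟨hν.trans hu, by linarith⟩, if_pos hp, if_pos hp]
      ring
    · rw [if_neg hp]
      split_ifs <;> simp
  -- measurability of `uncurry G`
  have hKm := measurable_entryKernel e
  have hGm : Measurable (Function.uncurry G) := by
    have h1 : Measurable fun p : ℝ × ℝ => (Set.Ioc (0 : ℝ) (1 / 2)).indicator (fun t => κ * Φ (1 - t)) p.1 :=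
      ((measurable_const.mul (hΦb.measurable.comp (measurable_id.const_sub 1))).indicator
        measurableSet_Ioc).comp measurable_fst
    have heq : Function.uncurry G = fun p : ℝ × ℝ => (Set.Ioo 0 p.1).indicator
        (fun u => if P p.1 u then 1 / (u * (p.1 - u)) else 0) p.2 *
        (Set.Ioc (0 : ℝ) (1 / 2)).indicator (fun t => κ * Φ (1 - t)) p.1 := by
      funext p
      simp only [Function.uncurry, hG, Set.indicator]
      split_ifs <;> ring
    rw [heq]
    exact hKm.mul h1
  -- bound and support of `G`
  have hGb : ∀ t u, |G t u| ≤ 1 / (1651 / 10000) ^ 2 * (|κ| * C) := by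
    intro t u
    rw [hGval]
    by_cases hp : P t u
    · obtain ⟨hu, htu, ht⟩ := hPpos t u hp
      have hpos : 0 < u * (t - u) := mul_pos (hν.trans hu) (hν.trans htu)
      rw [if_pos hp, abs_div, abs_of_pos hpos, abs_mul, div_le_iff₀ hpos]
      have h1 : |Φ (1 - t)| ≤ C := hC _ (by rw [abs_le]; constructor <;> linarith [hν.trans hu, hν.trans htu])
      have h2 : (1651 / 10000 : ℝ) ^ 2 ≤ u * (t - u) := by rw [sq]; exact mul_le_mul hu.le htu.le hν.le (hν.trans hu).le
      calc |κ| * |Φ (1 - t)| ≤ |κ| * C := mul_le_mul_of_nonneg_left h1 (abs_nonneg _)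
        _ = 1 / (1651 / 10000) ^ 2 * (|κ| * C) * (1651 / 10000) ^ 2 := by field_simp
        _ ≤ 1 / (1651 / 10000) ^ 2 * (|κ| * C) * (u * (t - u)) :=
            mul_le_mul_of_nonneg_left h2 (by positivity)
    · rw [if_neg hp, abs_zero]; positivity
  have hGsupp : ∀ t u, (t, u) ∉ Set.Icc (0 : ℝ) (1 / 2) ×ˢ Set.Icc (0 : ℝ) (1 / 2) → G t u = 0 := by
    intro t u h
    rw [hGval, if_neg]
    intro hp
    obtain ⟨hu, htu, ht⟩ := hPpos t u hp
    exact h ⟨⟨by linarith, ht.le⟩, ⟨(hν.trans hu).le, by linarith⟩⟩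
  have hGint : Integrable (Function.uncurry G) ((volume : Measure ℝ).prod volume) := by
    refine IntegrableOn.integrable_of_forall_notMem_eq_zero (s := Set.Icc (0 : ℝ) (1 / 2) ×ˢ Set.Icc (0 : ℝ) (1 / 2))
      ?_ (fun p hp => hGsupp p.1 p.2 hp)
    refine Measure.integrableOn_of_bounded (M := 1 / (1651 / 10000) ^ 2 * (|κ| * C)) ?_ hGm.aestronglyMeasurable
      (Filter.Eventually.of_forall fun p => by rw [Real.norm_eq_abs]; exact hGb p.1 p.2)
    rw [Measure.prod_prod]; exact ENNReal.mul_ne_top measure_Icc_lt_top.ne measure_Icc_lt_top.ne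
  -- the translated integrand `H(u, v) = G(u + v, u)`
  have hHm : Measurable (Function.uncurry fun u v => G (u + v) u) := by
    have : (Function.uncurry fun u v => G (u + v) u) = Function.uncurry G ∘ fun p : ℝ × ℝ => (p.1 + p.2, p.1) := by
      funext p; rfl
    rw [this]
    exact hGm.comp ((measurable_fst.add measurable_snd).prodMk measurable_fst)
  have hHint : Integrable (Function.uncurry fun u v => G (u + v) u) ((volume : Measure ℝ).prod volume) := by
    refine IntegrableOn.integrable_of_forall_notMem_eq_zero (s := Set.Icc (0 : ℝ) (1 / 2) ×ˢ Set.Icc (0 : ℝ) (1 / 2))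
      ?_ (fun p hp => ?_)
    · refine Measure.integrableOn_of_bounded (M := 1 / (1651 / 10000) ^ 2 * (|κ| * C)) ?_ hHm.aestronglyMeasurable
        (Filter.Eventually.of_forall fun p => by rw [Real.norm_eq_abs]; exact hGb _ _)
      rw [Measure.prod_prod]; exact ENNReal.mul_ne_top measure_Icc_lt_top.ne measure_Icc_lt_top.ne
    · show G (p.1 + p.2) p.1 = 0
      rw [hGval, if_neg]
      intro hq
      obtain ⟨hu, htu, ht⟩ := hPpos _ _ hq
      rw [add_sub_cancel_left] at htu
      exact hp ⟨⟨(hν.trans hu).le, by linarith [hν.trans htu]⟩, ⟨(hν.trans htu).le, by linarith [hν.trans hu]⟩⟩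
  -- Step 1: the iterated pairing is `∫∫ G`
  have hstep1 : ∫ t in Set.Ioc 0 (1 / 2), (∫ u in Set.Ioo 0 t, κ * (if P t u then 1 / (u * (t - u)) else 0)) *
      Φ (1 - t) = ∫ t, ∫ u, G t u := by
    rw [← integral_indicator measurableSet_Ioc]
    refine integral_congr_ae (Filter.Eventually.of_forall fun t => ?_)
    by_cases ht : t ∈ Set.Ioc (0 : ℝ) (1 / 2)
    · simp only [Set.indicator_of_mem ht, hG]
      rw [← integral_mul_const, ← integral_indicator measurableSet_Ioo]
      refine integral_congr_ae (Filter.Eventually.of_forall fun u => ?_)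
      simp only [Set.indicator]
      split_ifs <;> ring
    · simp only [Set.indicator_of_notMem ht, hG]
      simp
  -- Step 2: Fubini, translate, Fubini back
  rw [hstep1, integral_integral_swap hGint]
  have hstep2 : ∫ u, ∫ t, G t u = ∫ u, ∫ v, G (u + v) u := by
    refine integral_congr_ae (Filter.Eventually.of_forall fun u => ?_)
    exact (integral_add_left_eq_self (fun t => G t u) u).symm
  have h3 := integral_prod _ hHint
  simp only [Function.uncurry_apply_pair] at h3
  rw [hstep2, ← h3]
  refine integral_congr_ae (Filter.Eventually.of_forall fun p => ?_)
  show G (p.1 + p.2) p.1 = _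
  rw [hGval]
  simp only [hP, add_sub_cancel_left]
  rfl

end Summit.Parity.GeneralizedHardyLittlewood.FordMaynardSieveConst01651SieveConst01651

end
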